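import Literature.Barriers.ValiantsHypothesis.GCTMatrixPoweringProp17
import HarnessLib

/-!
# Gesmundo–Ikenmeyer–Panova 2017, Prop. 18 (corrected): reduction of the computer calculation to
# 64 two- and three-column shapes (the semigroup step PROVED; the finite base isolated)

Sibling proofs file (D-0014; theorems only — no `sorry`, no definition, no new named fact)
of `GCTMatrixPoweringErratum.lean` (the named fact `GIP2017_prop18_corrected`: "Let `λ` be a
partition of length `ℓ ≤ 14` and `λ ∉ {(1^r) : r ∈ X_s} ∪ {(2,1,1), (3,1,1), (2,1⁷)}` [∪ {(2,1³)},
the erratum]. Then `sm(λ, 7) > 0`") and of `GCTMatrixPoweringProp17.lean`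
(`gctMatrixPowering_of_prop18 : GIP2017_prop18_corrected → GCTMatrixPowering`: Prop. 18 corrected
is the LAST unproved ingredient of the barrier fact `GCTMatrixPowering = GIP2017_thm10`, Props. 15,
17 ("if"), 19 (corrected), 20 (corrected), 14, Lemma 12, Prop. 13 and Thm. 16 being proved).
Conventions as there (`SmPos m λ` = "`sm(λ, m) > 0`", `AmPos`, `ofColumns S` = the shape with
column lengths `S`, `gipXs = X_s = {2,3,4,7,8,12}`).

**The printed proof of Prop. 18** (arXiv:1611.00827 = Diff. Geom. Appl. 55 (2017), §3, held text
p. 11) is a COMPUTER CALCULATION plus the semigroup property: "We use a program written by Harm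
Derksen and adjusted by Jesko Hüttenhain ... A direct computation for partitions `λ` with
`ℓ(λ) ≤ 12` and `λ₁ ≤ 3` shows that `sm(λ,7) > 0` except for the cases listed above. We also verify
that `sm(λ,7) > 0` for the partitions with `ℓ(λ) = 13, 14` and `λ₂ = 1, 2` ... Let `λ₁ ≥ 4` ...
we can write `λ = (c) + Σ_i αⁱ`, where `αⁱ` are partitions with all columns longer than `1` and at
least two columns each ... Since the calculation showed that all partitions of `2` or `3` columns,
each of lengths `∈ [2,14]` have positive `sm`, we have `sm(αⁱ, 7) > 0`. Since `sm((c), 7) > 0`, the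
semigroup property for `sm` gives `sm(λ,7) > 0`." The computed base thus ranges over all shapes
with at most three columns of lengths `≤ 14` (up to `42` boxes).

**What this file proves.** The semigroup step, with a much smaller base. By Thm. 16 (proved,
`GCTMatrixPoweringColumnSign.lean`) and the explicit self-conjugate partitions of Prop. 17 with at
most `7` rows (`smPos_amPos_column_of_le`), every single column `1^c`, `c ≤ 14`, has a KNOWN type
at level `7`: `sm(1^c, 7) > 0` for `c ∈ {1,5,6,9,10,11,13,14}` (`smPos_seven_ofColumns_singleton`),
`am(1^c, 7) > 0` for `c ∈ {3,4,7,8,9,11,12,13}` (`amPos_seven_ofColumns_singleton`) — and nothing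
for `c = 2` (`sk(1², μ) = ak(1², μ) = 0`); the pair `1² + 1² = (2,2)` is positive by the doubling
`g(1², (2), 1²) > 0 ⇒ sk((2,2), (3,1)) > 0` (`smPos_ofColumns_two_two`, from
`skPos_rowAdd_self_of_kroneckerCoeff_pos`). With Prop. 15 at the level of the coefficients
(`sk·sk → sk`, `ak·ak → sk`, `sk·ak → ak`, proved in `GCTMatrixPoweringSemigroup.lean`) these
generate `sm(λ, 7) > 0` for every non-exceptional `λ` with columns `≤ 14` EXCEPT when a parity
obstruction or a column of length `2` intervenes, and an induction on the number of columns
(`smPos_seven_ofColumns_of_atoms`) reduces everything to the following **64 atoms** (two- and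
three-column shapes; a two-column shape `1^a + 1^b` has no row-sum decomposition other than into
its two columns, so for the 35 two-column `sm`-atoms a direct certificate is unavoidable in this
calculus):

* (A1) `sm(1² + 1^x, 7) > 0`, `x ∈ {1,3,4,…,14}` (13 shapes `(2,1)`, `(2,2,1^{x-2})`);
* (A2) `sm((3,3), 7) > 0` (`= 1²+1²+1²`);
* (A3) `sm(1^a + 1^b, 7) > 0`, `a ∈ {1,5,6,10,14}`, `b ∈ {3,4,7,8,12}`, `{a,b} ∉ {{1,3},{1,4},{1,8}}`
  (22 shapes; the three excluded ones are the exceptional `(2,1,1)`, `(2,1³)`, `(2,1⁷)`);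
* (A4) `am(1^x + 1^y, 7) > 0`, `x, y ∈ {3,4,7,8,12}`, `{x,y} ≠ {3,3}` (14 shapes; `am((2,2,2),7) = 0`);
* (A5) `sm((3,3,3), 7) > 0`;
* (A6) `am(1² + 1^x, 7) > 0`, `x ∈ {3,4,7,8,12}` (5);
* (A7) `sm(1² + 1² + 1^x, 7) > 0`, `x ∈ {3,4,7,8,12}` (5 shapes `(3,3,1^{x-2})`);
* (A8) `sm((4,1,1), 7)`, `sm((3,1,1,1), 7)`, `sm((3,1^7), 7) > 0`.

All 64 are instances of the printed calculation (each has at most three columns of lengths `≤ 14`)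
and were re-verified numerically in the vendoring session (Murnaghan–Nakayama; e.g.
`sk((2,1),(2,1)) = 1`, `sk((2^{12},1,1), (8,7,6,5)) = 1`, `ak((2^{12}), (7,7,6,4)) = 1`); they are
carried here as HYPOTHESES of `GIP2017_prop18_corrected_of_atoms` (explicit finite families, no
named fact), the tree having no character values of Specht modules to decide them. The main
theorem: **`GIP2017_prop18_corrected_of_atoms : (A1) → … → (A8) → GIP2017_prop18_corrected`**, via
the column multiset `λᵀ` of `λ` (the columns of the ten exceptional shapes, `parts_mem_gipExceptionalShapesCorrected_of_transpose`).

## References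

* [GesmundoIkenmeyerPanova2017] F. Gesmundo, C. Ikenmeyer, G. Panova, *Geometric complexity theory
  and matrix powering*, Diff. Geom. Appl. 55 (2017) 106–127 = arXiv:1611.00827, §3: Prop. 15,
  Thm. 16, Prop. 17 (proof: the table of self-conjugate partitions for `a ≤ 14`), Prop. 18 and its
  proof (held text p. 11).
* [FultonYoungTableaux1997] W. Fulton, *Young Tableaux* (1997), §0 (conjugate partition, columns).
-/

noncomputable section

open scoped BigOperators

namespace Literature.Barriers.ValiantsHypothesis

open Literature.NumberTheory.DiophantineGeometry Literature.Computability.Complexity Finset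

/-! ### 1. `sm`/`am` of the shape with prescribed columns: transfer and semigroup rules -/

section Transfer

variable {m a b : ℕ}

/-- `sm(λ, m) > 0` depends only on the rows of `λ` (Prop. 15(1) with the empty partition,
`sm(∅, m) > 0`). [cite: GesmundoIkenmeyerPanova2017, Prop. 15(1)] -/
theorem SmPos.of_rows_eq {lam : Nat.Partition a} {mu : Nat.Partition b}
    (h : ∀ r, lam.sortedParts.getD r 0 = mu.sortedParts.getD r 0) (hmu : SmPos m mu) :
    SmPos m lam :=
  smPos_of_isRowSum (lam' := ofColumns 0)
    (fun r => by rw [h r, getD_sortedParts_ofColumns, colCount_zero, add_zero]) hmu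
    (smPos_of_eq_zero Multiset.sum_zero _ _)

/-- `am(λ, m) > 0` depends only on the rows of `λ` (Prop. 15(3) with `sm(∅, m) > 0`).
[cite: GesmundoIkenmeyerPanova2017, Prop. 15(3)] -/
theorem AmPos.of_rows_eq {lam : Nat.Partition a} {mu : Nat.Partition b}
    (h : ∀ r, lam.sortedParts.getD r 0 = mu.sortedParts.getD r 0) (hmu : AmPos m mu) :
    AmPos m lam :=
  amPos_of_isRowSum (lam := ofColumns 0)
    (fun r => by rw [h r, getD_sortedParts_ofColumns, colCount_zero, zero_add])
    (smPos_of_eq_zero Multiset.sum_zero _ _) hmu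

/-- **Prop. 15(1) on column multisets**: `sm > 0` for the columns `S` and for the columns `T` gives
`sm > 0` for the columns `S + T`. [cite: GesmundoIkenmeyerPanova2017, Prop. 15(1)] -/
theorem smPos_ofColumns_add {S T : Multiset ℕ} (hS : SmPos m (ofColumns S))
    (hT : SmPos m (ofColumns T)) : SmPos m (ofColumns (S + T)) :=
  smPos_of_isRowSum (isRowSum_of_colCount (getD_sortedParts_ofColumns (S + T))
    (getD_sortedParts_ofColumns S) (getD_sortedParts_ofColumns T)) hS hT

/-- **Prop. 15(2) on column multisets**: `am · am → sm`. [cite: GesmundoIkenmeyerPanova2017, Prop. 15(2)] -/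
theorem smPos_ofColumns_add_of_amPos {S T : Multiset ℕ} (hS : AmPos m (ofColumns S))
    (hT : AmPos m (ofColumns T)) : SmPos m (ofColumns (S + T)) :=
  smPos_of_isRowSum_of_amPos (isRowSum_of_colCount (getD_sortedParts_ofColumns (S + T))
    (getD_sortedParts_ofColumns S) (getD_sortedParts_ofColumns T)) hS hT

/-- **Prop. 15(3) on column multisets**: `sm · am → am`. [cite: GesmundoIkenmeyerPanova2017, Prop. 15(3)] -/
theorem amPos_ofColumns_add {S T : Multiset ℕ} (hS : SmPos m (ofColumns S))
    (hT : AmPos m (ofColumns T)) : AmPos m (ofColumns (S + T)) :=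
  amPos_of_isRowSum (isRowSum_of_colCount (getD_sortedParts_ofColumns (S + T))
    (getD_sortedParts_ofColumns S) (getD_sortedParts_ofColumns T)) hS hT

/-- Rewriting the column multiset. [folklore] -/
theorem smPos_ofColumns_congr {S T : Multiset ℕ} (h : S = T) (hS : SmPos m (ofColumns S)) :
    SmPos m (ofColumns T) := by
  subst h
  exact hS

/-- Adding one column with `sm > 0`. [cite: GesmundoIkenmeyerPanova2017, Prop. 15(1)] -/
theorem smPos_ofColumns_cons {c : ℕ} {T : Multiset ℕ} (hc : SmPos m (ofColumns {c}))
    (hT : SmPos m (ofColumns T)) : SmPos m (ofColumns (c ::ₘ T)) :=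
  smPos_ofColumns_congr (Multiset.singleton_add c T) (smPos_ofColumns_add hc hT)

/-- The shape with the single column `c` is the column `1^c`. [folklore] -/
theorem smPos_ofColumns_singleton_iff (c : ℕ) :
    SmPos m (ofColumns {c}) ↔ SmPos m (Nat.Partition.column c) :=
  ⟨fun h => SmPos.of_rows_eq (fun r => by rw [getD_sortedParts_column, getD_sortedParts_ofColumns]) h,
    fun h => SmPos.of_rows_eq (fun r => by rw [getD_sortedParts_column, getD_sortedParts_ofColumns]) h⟩

/-- The shape with the single column `c` is the column `1^c` (`am` form). [folklore] -/
theorem amPos_ofColumns_singleton_iff (c : ℕ) :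
    AmPos m (ofColumns {c}) ↔ AmPos m (Nat.Partition.column c) :=
  ⟨fun h => AmPos.of_rows_eq (fun r => by rw [getD_sortedParts_column, getD_sortedParts_ofColumns]) h,
    fun h => AmPos.of_rows_eq (fun r => by rw [getD_sortedParts_column, getD_sortedParts_ofColumns]) h⟩

end Transfer

/-! ### 2. The known level-7 types: single columns (Thm. 16, Prop. 17's table) and `1² + 1²` -/

section Columns

/-- **Columns with `sm(1^c, 7) > 0`, `c ≤ 14`: `c ∈ {1,5,6,9,10,11,13,14}`** — Thm. 16 with the
self-conjugate partitions of EVEN sign and at most `7` rows `(1)`, `(3,1,1)`, `(3,2,1)`, `(5,1⁴)`,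
`(5,2,1³)`, `(4,3,3,1)`, `(7,1⁶)`, `(7,2,1⁵)` (Prop. 17's table; Durfee size `d`, `c = d² + 2h`).
[cite: GesmundoIkenmeyerPanova2017, Prop. 17 (proof, the table for a ≤ 14) and Thm. 16] -/
theorem smPos_seven_ofColumns_singleton {c : ℕ}
    (hc : c = 1 ∨ c = 5 ∨ c = 6 ∨ c = 9 ∨ c = 10 ∨ c = 11 ∨ c = 13 ∨ c = 14) :
    SmPos 7 (ofColumns {c}) := by
  rw [smPos_ofColumns_singleton_iff]
  have W : ∀ d h : ℕ, 1 ≤ d → d ≤ 7 → c = d * d + 2 * h → h ≤ d * (7 - d) →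
      Even ((c - d) / 2) → SmPos 7 (Nat.Partition.column c) :=
    fun d h hd hdL hD hcap => (smPos_amPos_column_of_le hd hdL hD hcap).1
  rcases hc with rfl | rfl | rfl | rfl | rfl | rfl | rfl | rfl
  · exact W 1 0 (by norm_num) (by norm_num) (by norm_num) (by norm_num) (by decide)
  · exact W 1 2 (by norm_num) (by norm_num) (by norm_num) (by norm_num) (by decide)
  · exact W 2 1 (by norm_num) (by norm_num) (by norm_num) (by norm_num) (by decide)
  · exact W 1 4 (by norm_num) (by norm_num) (by norm_num) (by norm_num) (by decide)
  · exact W 2 3 (by norm_num) (by norm_num) (by norm_num) (by norm_num) (by decide)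
  · exact W 3 1 (by norm_num) (by norm_num) (by norm_num) (by norm_num) (by decide)
  · exact W 1 6 (by norm_num) (by norm_num) (by norm_num) (by norm_num) (by decide)
  · exact W 2 5 (by norm_num) (by norm_num) (by norm_num) (by norm_num) (by decide)

/-- **Columns with `am(1^c, 7) > 0`, `c ≤ 14`: `c ∈ {3,4,7,8,9,11,12,13}`** — Thm. 16 with the
self-conjugate partitions of ODD sign `(2,1)`, `(2,2)`, `(4,1³)`, `(4,2,1,1)`, `(3,3,3)`, `(6,1⁵)`,
`(6,2,1⁴)`, `(5,3,3,1,1)` (Prop. 17's table). [cite: GesmundoIkenmeyerPanova2017, Prop. 17 (proof, the table for a ≤ 14) and Thm. 16] -/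
theorem amPos_seven_ofColumns_singleton {c : ℕ}
    (hc : c = 3 ∨ c = 4 ∨ c = 7 ∨ c = 8 ∨ c = 9 ∨ c = 11 ∨ c = 12 ∨ c = 13) :
    AmPos 7 (ofColumns {c}) := by
  rw [amPos_ofColumns_singleton_iff]
  have W : ∀ d h : ℕ, 1 ≤ d → d ≤ 7 → c = d * d + 2 * h → h ≤ d * (7 - d) →
      Odd ((c - d) / 2) → AmPos 7 (Nat.Partition.column c) :=
    fun d h hd hdL hD hcap => (smPos_amPos_column_of_le hd hdL hD hcap).2
  rcases hc with rfl | rfl | rfl | rfl | rfl | rfl | rfl | rfl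
  · exact W 1 1 (by norm_num) (by norm_num) (by norm_num) (by norm_num) (by decide)
  · exact W 2 0 (by norm_num) (by norm_num) (by norm_num) (by norm_num) (by decide)
  · exact W 1 3 (by norm_num) (by norm_num) (by norm_num) (by norm_num) (by decide)
  · exact W 2 2 (by norm_num) (by norm_num) (by norm_num) (by norm_num) (by decide)
  · exact W 3 0 (by norm_num) (by norm_num) (by norm_num) (by norm_num) (by decide)
  · exact W 1 5 (by norm_num) (by norm_num) (by norm_num) (by norm_num) (by decide)
  · exact W 2 4 (by norm_num) (by norm_num) (by norm_num) (by norm_num) (by decide)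
  · exact W 3 2 (by norm_num) (by norm_num) (by norm_num) (by norm_num) (by decide)

/-- **`sm(1² + 1², m) > 0` (`m ≥ 2`)**: the doubling `g(1², (2), 1²) = 1 > 0 ⇒ sk((2,2), (2)+(1,1)) =
sk((2,2),(3,1)) > 0` (`skPos_rowAdd_self_of_kroneckerCoeff_pos`), the only source of positivity for
columns of length `2`. [cite: GesmundoIkenmeyerPanova2017, Prop. 15 (proof: multiplying highest weight vectors)] -/
theorem smPos_ofColumns_two_two {m : ℕ} (hm : 2 ≤ m) : SmPos m (ofColumns {2, 2}) := by
  have hsk := skPos_rowAdd_self_of_kroneckerCoeff_pos (Nat.Partition.column 2)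
    (Nat.Partition.indiscrete 2) (Nat.Partition.column 2)
    (kroneckerCoeff_pos_column_indiscrete_column 2)
  have hsm : SmPos m ((Nat.Partition.column 2).rowAdd (Nat.Partition.column 2)) := by
    refine ⟨_, (card_parts_rowAdd_le _ _).trans (max_le ?_ ?_), hsk⟩
    · rw [Nat.Partition.indiscrete_parts two_ne_zero, Multiset.card_singleton]; omega
    · rw [card_parts_column]; exact hm
  refine SmPos.of_rows_eq (fun r => ?_) hsm
  rw [getD_sortedParts_ofColumns, getD_sortedParts_rowAdd, getD_sortedParts_column,
    Multiset.insert_eq_cons, colCount_cons, colCount_singleton]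

end Columns

/-! ### 3. The columns of the ten exceptional shapes -/

section Exceptional

/-- Membership in the exceptional column multisets, spelled out. [cite: GesmundoIkenmeyerPanova2017, Prop. 18 (the exceptional list)] -/
theorem mem_gipExcCols_iff (S : Multiset ℕ) :
    S ∈ ({ {2}, {3}, {4}, {7}, {8}, {12}, {3, 1}, {4, 1}, {8, 1}, {3, 1, 1} } : Finset (Multiset ℕ)) ↔
      S = {2} ∨ S = {3} ∨ S = {4} ∨ S = {7} ∨ S = {8} ∨ S = {12} ∨ S = {3, 1} ∨ S = {4, 1} ∨
        S = {8, 1} ∨ S = {3, 1, 1} := by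
  simp only [Finset.mem_insert, Finset.mem_singleton]

/-- An exceptional column multiset without a column of length `1` is a single column of length
`r ∈ X_s`. [cite: GesmundoIkenmeyerPanova2017, Prop. 18] -/
theorem exists_eq_singleton_of_mem_gipExcCols {S : Multiset ℕ}
    (hS : S ∈ ({ {2}, {3}, {4}, {7}, {8}, {12}, {3, 1}, {4, 1}, {8, 1}, {3, 1, 1} } : Finset (Multiset ℕ)))
    (h1 : (1 : ℕ) ∉ S) :
    ∃ r, S = {r} ∧ (r = 2 ∨ r = 3 ∨ r = 4 ∨ r = 7 ∨ r = 8 ∨ r = 12) := by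
  rw [mem_gipExcCols_iff] at hS
  rcases hS with rfl | rfl | rfl | rfl | rfl | rfl | rfl | rfl | rfl | rfl
  · exact ⟨2, rfl, by norm_num⟩
  · exact ⟨3, rfl, by norm_num⟩
  · exact ⟨4, rfl, by norm_num⟩
  · exact ⟨7, rfl, by norm_num⟩
  · exact ⟨8, rfl, by norm_num⟩
  · exact ⟨12, rfl, by norm_num⟩
  all_goals exact absurd (by simp) h1

/-- **If the columns of `λ` form an exceptional column multiset then `λ` is one of the ten
exceptional shapes** (rows from columns: `λ_{r+1} = #{j : λ'_j > r}`).
[cite: GesmundoIkenmeyerPanova2017, Prop. 18 (the exceptional list)] [cite: FultonYoungTableaux1997, §0 (conjugate partition)] -/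
theorem parts_mem_gipExceptionalShapesCorrected_of_transpose {D : ℕ} (lam : Nat.Partition D)
    (h : lam.transpose.parts ∈
      ({ {2}, {3}, {4}, {7}, {8}, {12}, {3, 1}, {4, 1}, {8, 1}, {3, 1, 1} } : Finset (Multiset ℕ))) :
    lam.parts ∈ gipExceptionalShapesCorrected := by
  have hlamC : ∀ r, lam.sortedParts.getD r 0 = colCount lam.transpose.parts r :=
    getD_sortedParts_eq_colCount_transpose lam
  -- single columns
  have hcol : ∀ r, r ∈ gipXs → lam.transpose.parts = {r} → lam.parts ∈ gipExceptionalShapesCorrected := by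
    intro r hr h
    have hparts : lam.parts = (Nat.Partition.column r).parts :=
      Literature.Computability.Complexity.parts_eq_of_getD_sortedParts_eq fun i => by
        rw [hlamC, h, getD_sortedParts_column]
    rw [hparts, Nat.Partition.column_parts]
    exact (replicate_mem_gipExceptionalShapesCorrected_iff r).mpr hr
  -- hooks `(a, 1^k)` written as block partitions
  have hhook : ∀ (a k N : ℕ) (ha : 1 ≤ a) (hN : 1 * a + k * 1 + 0 * 1 + 0 * 1 + 0 * 1 = N),
      lam.transpose.parts = (k + 1) ::ₘ Multiset.replicate (a - 1) 1 →
        lam.parts = (blocks 1 a k 1 0 1 0 1 0 1 (N := N) (by omega) hN).parts := by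
    intro a k N ha hN h
    refine Literature.Computability.Complexity.parts_eq_of_getD_sortedParts_eq fun i => ?_
    rw [hlamC, h, getD_sortedParts_blocks, colCount_cons, colCount_replicate]
    split_ifs <;> omega
  rw [mem_gipExcCols_iff] at h
  rcases h with h | h | h | h | h | h | h | h | h | h
  · exact hcol 2 (by decide) h
  · exact hcol 3 (by decide) h
  · exact hcol 4 (by decide) h
  · exact hcol 7 (by decide) h
  · exact hcol 8 (by decide) h
  · exact hcol 12 (by decide) h
  · rw [hhook 2 2 4 (by norm_num) (by norm_num) (h.trans (by decide)), blocks_parts]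
    decide
  · rw [hhook 2 3 5 (by norm_num) (by norm_num) (h.trans (by decide)), blocks_parts]
    decide
  · rw [hhook 2 7 9 (by norm_num) (by norm_num) (h.trans (by decide)), blocks_parts]
    decide
  · rw [hhook 3 2 5 (by norm_num) (by norm_num) (h.trans (by decide)), blocks_parts]
    decide

end Exceptional

/-! ### 4. The induction on the number of columns -/

section Induction

/-- **Two typed columns of opposite parity**: `1^c` with `c ∈ {1,5,6,9,10,11,13,14}` and `1^r` with
`r ∈ {3,4,7,8,12}` give `sm(1^c + 1^r, 7) > 0` — by `am·am → sm` when `c ∈ {9,11,13}` also has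
`am > 0`, and by the atom (A3) otherwise. [cite: GesmundoIkenmeyerPanova2017, Prop. 18 (proof) and Prop. 15(2)] -/
theorem smPos_seven_ofColumns_pair
    (hA3 : ∀ a ∈ ({1, 5, 6, 10, 14} : Finset ℕ), ∀ b ∈ ({3, 4, 7, 8, 12} : Finset ℕ),
      ¬ (a = 1 ∧ (b = 3 ∨ b = 4 ∨ b = 8)) → SmPos 7 (ofColumns {a, b}))
    {c r : ℕ} (hc : c = 1 ∨ c = 5 ∨ c = 6 ∨ c = 9 ∨ c = 10 ∨ c = 11 ∨ c = 13 ∨ c = 14)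
    (hr : r = 3 ∨ r = 4 ∨ r = 7 ∨ r = 8 ∨ r = 12) (hexc : ¬ (c = 1 ∧ (r = 3 ∨ r = 4 ∨ r = 8))) :
    SmPos 7 (ofColumns {c, r}) := by
  by_cases hcb : c = 9 ∨ c = 11 ∨ c = 13
  · exact smPos_ofColumns_congr (Multiset.singleton_add c {r})
      (smPos_ofColumns_add_of_amPos (amPos_seven_ofColumns_singleton (by omega))
        (amPos_seven_ofColumns_singleton (by omega)))
  · refine hA3 c ?_ r ?_ hexc
    · simp only [Finset.mem_insert, Finset.mem_singleton]; omega
    · simp only [Finset.mem_insert, Finset.mem_singleton]; omega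

/-- **The semigroup step of Prop. 18 (corrected), from the 64 atoms (A1)–(A8).** For every
multiset `C` of column lengths in `[1, 14]` other than the ten exceptional ones, `sm(λ_C, 7) > 0`
for the shape `λ_C` with columns `C` — by induction on `#C`: remove an `sm`-typed column
(`{1,5,6,9,10,11,13,14}`), or a pair `1²+1²`, or a pair of `am`-typed columns, or `1²+1^x`, and
recurse; when the remainder is exceptional (or empty) the whole of `C` has at most four columns
and is an atom, a typed combination of atoms and columns, or excluded. The printed proof runs the
same recursion with the computed table as base ("we can write `λ = (c) + Σ αⁱ` ... the semigroup
property for `sm` gives `sm(λ,7) > 0`"). [cite: GesmundoIkenmeyerPanova2017, Prop. 18 (proof) and Prop. 15] -/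
theorem smPos_seven_ofColumns_of_atoms
    (hA1 : ∀ x ∈ ({1, 3, 4, 5, 6, 7, 8, 9, 10, 11, 12, 13, 14} : Finset ℕ), SmPos 7 (ofColumns {2, x}))
    (hA2 : SmPos 7 (ofColumns {2, 2, 2}))
    (hA3 : ∀ a ∈ ({1, 5, 6, 10, 14} : Finset ℕ), ∀ b ∈ ({3, 4, 7, 8, 12} : Finset ℕ),
      ¬ (a = 1 ∧ (b = 3 ∨ b = 4 ∨ b = 8)) → SmPos 7 (ofColumns {a, b}))
    (hA4 : ∀ x ∈ ({3, 4, 7, 8, 12} : Finset ℕ), ∀ y ∈ ({3, 4, 7, 8, 12} : Finset ℕ),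
      ¬ (x = 3 ∧ y = 3) → AmPos 7 (ofColumns {x, y}))
    (hA5 : SmPos 7 (ofColumns {3, 3, 3}))
    (hA6 : ∀ x ∈ ({3, 4, 7, 8, 12} : Finset ℕ), AmPos 7 (ofColumns {2, x}))
    (hA7 : ∀ x ∈ ({3, 4, 7, 8, 12} : Finset ℕ), SmPos 7 (ofColumns {2, 2, x}))
    (hA8 : SmPos 7 (ofColumns {3, 1, 1, 1}) ∧ SmPos 7 (ofColumns {4, 1, 1}) ∧
      SmPos 7 (ofColumns {8, 1, 1})) :
    ∀ (n : ℕ) (C : Multiset ℕ), C.card ≤ n → (∀ c ∈ C, 1 ≤ c ∧ c ≤ 14) →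
      C ∉ ({ {2}, {3}, {4}, {7}, {8}, {12}, {3, 1}, {4, 1}, {8, 1}, {3, 1, 1} } : Finset (Multiset ℕ)) →
        SmPos 7 (ofColumns C) := by
  -- membership in the finite index sets of the atoms, from arithmetic descriptions
  have memA : ∀ x, (x = 3 ∨ x = 4 ∨ x = 7 ∨ x = 8 ∨ x = 12) → x ∈ ({3, 4, 7, 8, 12} : Finset ℕ) :=
    fun x hx => by simp only [Finset.mem_insert, Finset.mem_singleton]; omega
  have mem1 : ∀ x, 1 ≤ x → x ≤ 14 → x ≠ 2 →
      x ∈ ({1, 3, 4, 5, 6, 7, 8, 9, 10, 11, 12, 13, 14} : Finset ℕ) :=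
    fun x h1 h14 h2 => by simp only [Finset.mem_insert, Finset.mem_singleton]; omega
  intro n
  induction n with
  | zero =>
    intro C hcard _ _
    obtain rfl : C = 0 := Multiset.card_eq_zero.mp (Nat.le_zero.mp hcard)
    exact smPos_of_eq_zero Multiset.sum_zero _ _
  | succ n ih =>
    intro C hcard hgood hexc
    by_cases hS : ∃ c ∈ C, c = 1 ∨ c = 5 ∨ c = 6 ∨ c = 9 ∨ c = 10 ∨ c = 11 ∨ c = 13 ∨ c = 14
    · -- (i) an `sm`-typed column `c`
      obtain ⟨c, hcC, hc⟩ := hS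
      obtain ⟨C', rfl⟩ := Multiset.exists_cons_of_mem hcC
      have hcard' : C'.card ≤ n := by rw [Multiset.card_cons] at hcard; omega
      have hgood' : ∀ x ∈ C', 1 ≤ x ∧ x ≤ 14 := fun x hx => hgood x (Multiset.mem_cons_of_mem hx)
      have hsc : SmPos 7 (ofColumns {c}) := smPos_seven_ofColumns_singleton hc
      have hs1 : SmPos 7 (ofColumns {1}) := smPos_seven_ofColumns_singleton (Or.inl rfl)
      by_cases hexc' : C' ∈ ({ {2}, {3}, {4}, {7}, {8}, {12}, {3, 1}, {4, 1}, {8, 1}, {3, 1, 1} } : Finset (Multiset ℕ))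
      · rw [mem_gipExcCols_iff] at hexc'
        rcases hexc' with rfl | rfl | rfl | rfl | rfl | rfl | rfl | rfl | rfl | rfl
        · -- `C = {c, 2}`: atom (A1)
          have h1 := hgood c hcC
          exact smPos_ofColumns_congr (Multiset.pair_comm 2 c) (hA1 c (mem1 c h1.1 h1.2 (by omega)))
        · exact smPos_seven_ofColumns_pair hA3 hc (by norm_num)
            fun h => hexc (by obtain ⟨rfl, -⟩ := h; decide)
        · exact smPos_seven_ofColumns_pair hA3 hc (by norm_num)
            fun h => hexc (by obtain ⟨rfl, -⟩ := h; decide)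
        · exact smPos_seven_ofColumns_pair hA3 hc (by norm_num) (by omega)
        · exact smPos_seven_ofColumns_pair hA3 hc (by norm_num)
            fun h => hexc (by obtain ⟨rfl, -⟩ := h; decide)
        · exact smPos_seven_ofColumns_pair hA3 hc (by norm_num) (by omega)
        · -- `C = c + {3, 1}`
          rcases hc with rfl | hc
          · exact absurd (by decide) hexc
          · have hne : ¬ (c = 1 ∧ (3 = 3 ∨ 3 = 4 ∨ 3 = 8)) := by omega
            have h := smPos_ofColumns_add (smPos_seven_ofColumns_pair hA3 (Or.inr hc) (Or.inl rfl) hne) hs1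
            rwa [Multiset.insert_eq_cons, Multiset.cons_add, Multiset.singleton_add] at h
        · -- `C = c + {4, 1}`
          rcases hc with rfl | hc
          · exact smPos_ofColumns_congr (by decide) hA8.2.1
          · have hne : ¬ (c = 1 ∧ (4 = 3 ∨ 4 = 4 ∨ 4 = 8)) := by omega
            have h := smPos_ofColumns_add
              (smPos_seven_ofColumns_pair hA3 (Or.inr hc) (Or.inr (Or.inl rfl)) hne) hs1
            rwa [Multiset.insert_eq_cons, Multiset.cons_add, Multiset.singleton_add] at h
        · -- `C = c + {8, 1}`
          rcases hc with rfl | hc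
          · exact smPos_ofColumns_congr (by decide) hA8.2.2
          · have hne : ¬ (c = 1 ∧ (8 = 3 ∨ 8 = 4 ∨ 8 = 8)) := by omega
            have h := smPos_ofColumns_add
              (smPos_seven_ofColumns_pair hA3 (Or.inr hc) (Or.inr (Or.inr (Or.inr (Or.inl rfl)))) hne)
              hs1
            rwa [Multiset.insert_eq_cons, Multiset.cons_add, Multiset.singleton_add] at h
        · -- `C = c + {3, 1, 1}`
          rcases hc with rfl | hc
          · exact smPos_ofColumns_congr (by decide) hA8.1
          · have hne : ¬ (c = 1 ∧ (3 = 3 ∨ 3 = 4 ∨ 3 = 8)) := by omega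
            have h := smPos_ofColumns_add (smPos_seven_ofColumns_pair hA3 (Or.inr hc) (Or.inl rfl) hne)
              (smPos_ofColumns_cons hs1 hs1)
            rwa [Multiset.insert_eq_cons, Multiset.cons_add, Multiset.singleton_add] at h
      · exact smPos_ofColumns_cons hsc (ih C' hcard' hgood' hexc')
    · -- (ii) all columns lie in `X_s = {2,3,4,7,8,12}`
      push Not at hS
      have hrest : ∀ c ∈ C, c = 2 ∨ (c = 3 ∨ c = 4 ∨ c = 7 ∨ c = 8 ∨ c = 12) := fun c hc => by
        have h1 := hgood c hc
        have h2 := hS c hc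
        omega
      by_cases h2 : (2 : ℕ) ∈ C
      · obtain ⟨C₁, rfl⟩ := Multiset.exists_cons_of_mem h2
        by_cases h2' : (2 : ℕ) ∈ C₁
        · -- two columns of length `2`: remove `1² + 1²`
          obtain ⟨C₂, rfl⟩ := Multiset.exists_cons_of_mem h2'
          have hcard₂ : C₂.card ≤ n := by
            rw [Multiset.card_cons, Multiset.card_cons] at hcard; omega
          have hgood₂ : ∀ x ∈ C₂, 1 ≤ x ∧ x ≤ 14 := fun x hx =>
            hgood x (Multiset.mem_cons_of_mem (Multiset.mem_cons_of_mem hx))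
          have hrest₂ : ∀ x ∈ C₂, x = 2 ∨ (x = 3 ∨ x = 4 ∨ x = 7 ∨ x = 8 ∨ x = 12) := fun x hx =>
            hrest x (Multiset.mem_cons_of_mem (Multiset.mem_cons_of_mem hx))
          by_cases hexc₂ :
            C₂ ∈ ({ {2}, {3}, {4}, {7}, {8}, {12}, {3, 1}, {4, 1}, {8, 1}, {3, 1, 1} } : Finset (Multiset ℕ))
          · obtain ⟨r, rfl, hr⟩ := exists_eq_singleton_of_mem_gipExcCols hexc₂
              (fun h1 => by have := hrest₂ 1 h1; omega)
            rcases hr with rfl | hr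
            · exact hA2
            · exact hA7 r (memA r hr)
          · have h := smPos_ofColumns_add (smPos_ofColumns_two_two (by norm_num)) (ih C₂ hcard₂ hgood₂ hexc₂)
            rwa [Multiset.insert_eq_cons, Multiset.cons_add, Multiset.singleton_add] at h
        · -- exactly one column of length `2`: remove `1² + 1^x`
          have hC₁ : ∀ x ∈ C₁, x = 3 ∨ x = 4 ∨ x = 7 ∨ x = 8 ∨ x = 12 := fun x hx => by
            rcases hrest x (Multiset.mem_cons_of_mem hx) with rfl | h
            · exact absurd hx h2'
            · exact h
          rcases Multiset.empty_or_exists_mem C₁ with rfl | ⟨x, hx⟩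
          · exact absurd (by decide) hexc
          · obtain ⟨C₂, rfl⟩ := Multiset.exists_cons_of_mem hx
            have hxa := hC₁ x (Multiset.mem_cons_self x C₂)
            have hcard₂ : C₂.card ≤ n := by
              rw [Multiset.card_cons, Multiset.card_cons] at hcard; omega
            have hgood₂ : ∀ y ∈ C₂, 1 ≤ y ∧ y ≤ 14 := fun y hy =>
              hgood y (Multiset.mem_cons_of_mem (Multiset.mem_cons_of_mem hy))
            have hC₂ : ∀ y ∈ C₂, y = 3 ∨ y = 4 ∨ y = 7 ∨ y = 8 ∨ y = 12 := fun y hy =>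
              hC₁ y (Multiset.mem_cons_of_mem hy)
            by_cases hexc₂ :
            C₂ ∈ ({ {2}, {3}, {4}, {7}, {8}, {12}, {3, 1}, {4, 1}, {8, 1}, {3, 1, 1} } : Finset (Multiset ℕ))
            · obtain ⟨r, rfl, -⟩ := exists_eq_singleton_of_mem_gipExcCols hexc₂
                (fun h1 => by have := hC₂ 1 h1; omega)
              have hra := hC₂ r (Multiset.mem_singleton_self r)
              have h := smPos_ofColumns_add_of_amPos (hA6 x (memA x hxa))
                (amPos_seven_ofColumns_singleton (c := r) (by omega))
              rwa [Multiset.insert_eq_cons, Multiset.cons_add, Multiset.singleton_add] at h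
            · have h := smPos_ofColumns_add (hA1 x (mem1 x (by omega) (by omega) (by omega)))
                (ih C₂ hcard₂ hgood₂ hexc₂)
              rwa [Multiset.insert_eq_cons, Multiset.cons_add, Multiset.singleton_add] at h
      · -- no column of length `2`: all columns are `am`-typed
        have hCa : ∀ c ∈ C, c = 3 ∨ c = 4 ∨ c = 7 ∨ c = 8 ∨ c = 12 := fun c hc => by
          rcases hrest c hc with rfl | h
          · exact absurd hc h2
          · exact h
        rcases Multiset.empty_or_exists_mem C with rfl | ⟨x, hx⟩
        · exact smPos_of_eq_zero Multiset.sum_zero _ _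
        · obtain ⟨C₁, rfl⟩ := Multiset.exists_cons_of_mem hx
          have hxa := hCa x (Multiset.mem_cons_self x C₁)
          rcases Multiset.empty_or_exists_mem C₁ with rfl | ⟨y, hy⟩
          · exfalso
            apply hexc
            rcases hxa with rfl | rfl | rfl | rfl | rfl <;> decide
          · obtain ⟨C₂, rfl⟩ := Multiset.exists_cons_of_mem hy
            have hya := hCa y (Multiset.mem_cons_of_mem (Multiset.mem_cons_self y C₂))
            have hcard₂ : C₂.card ≤ n := by
              rw [Multiset.card_cons, Multiset.card_cons] at hcard; omega
            have hgood₂ : ∀ z ∈ C₂, 1 ≤ z ∧ z ≤ 14 := fun z hz =>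
              hgood z (Multiset.mem_cons_of_mem (Multiset.mem_cons_of_mem hz))
            have hC₂ : ∀ z ∈ C₂, z = 3 ∨ z = 4 ∨ z = 7 ∨ z = 8 ∨ z = 12 := fun z hz =>
              hCa z (Multiset.mem_cons_of_mem (Multiset.mem_cons_of_mem hz))
            by_cases hexc₂ :
            C₂ ∈ ({ {2}, {3}, {4}, {7}, {8}, {12}, {3, 1}, {4, 1}, {8, 1}, {3, 1, 1} } : Finset (Multiset ℕ))
            · -- three `am`-typed columns `x, y, r`
              obtain ⟨r, rfl, -⟩ := exists_eq_singleton_of_mem_gipExcCols hexc₂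
                (fun h1 => by have := hC₂ 1 h1; omega)
              have hra := hC₂ r (Multiset.mem_singleton_self r)
              by_cases h33 : x = 3 ∧ y = 3
              · obtain ⟨rfl, rfl⟩ := h33
                by_cases hr3 : r = 3
                · subst hr3
                  exact hA5
                · have h := smPos_ofColumns_add_of_amPos (hA4 3 (memA 3 (Or.inl rfl)) r (memA r hra)
                    (by omega)) (amPos_seven_ofColumns_singleton (c := 3) (Or.inl rfl))
                  rw [Multiset.insert_eq_cons, Multiset.cons_add, Multiset.singleton_add] at h
                  exact smPos_ofColumns_congr (congrArg _ (Multiset.pair_comm r 3)) h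
              · have h := smPos_ofColumns_add_of_amPos (hA4 x (memA x hxa) y (memA y hya) h33)
                  (amPos_seven_ofColumns_singleton (c := r) (by omega))
                rwa [Multiset.insert_eq_cons, Multiset.cons_add, Multiset.singleton_add] at h
            · have hxy : SmPos 7 (ofColumns {x, y}) :=
                smPos_ofColumns_congr (Multiset.singleton_add x {y})
                  (smPos_ofColumns_add_of_amPos (amPos_seven_ofColumns_singleton (by omega))
                    (amPos_seven_ofColumns_singleton (by omega)))
              have h := smPos_ofColumns_add hxy (ih C₂ hcard₂ hgood₂ hexc₂)
              rwa [Multiset.insert_eq_cons, Multiset.cons_add, Multiset.singleton_add] at h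

end Induction

/-! ### 5. Prop. 18 (corrected) from the atoms -/

section Assembly

/-- **GIP Prop. 18 (corrected) from its 64 atomic computations.** If
(A1) `sm(1² + 1^x, 7) > 0` for `x ∈ {1,3,4,…,14}`; (A2) `sm((3,3), 7) > 0`;
(A3) `sm(1^a + 1^b, 7) > 0` for `a ∈ {1,5,6,10,14}`, `b ∈ {3,4,7,8,12}`, `1^a+1^b` not exceptional;
(A4) `am(1^x + 1^y, 7) > 0` for `x, y ∈ {3,4,7,8,12}`, `(x,y) ≠ (3,3)`; (A5) `sm((3,3,3), 7) > 0`;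
(A6) `am(1² + 1^x, 7) > 0` and (A7) `sm(1² + 1² + 1^x, 7) > 0` for `x ∈ {3,4,7,8,12}`;
(A8) `sm((4,1,1), 7)`, `sm((3,1,1,1), 7)`, `sm((3,1⁷), 7) > 0` — all instances of the printed
computer calculation ("all partitions of 2 or 3 columns, each of lengths `∈ [2,14]`", "`λ₂ = 1, 2`",
"`sm(1^k + (3), k) > 0`") — then "Let `λ` be a partition of length `ℓ ≤ 14` and
`λ ∉ {(1^r) : r ∈ X_s} ∪ {(2,1,1), (2,1³), (3,1,1), (2,1⁷)}`. Then `sm(λ,7) > 0`": the columns of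
`λ` have lengths `≤ 14` and do not form an exceptional column multiset, so
`smPos_seven_ofColumns_of_atoms` applies to `λᵀ` and `λ` has the rows of the shape with columns
`λᵀ`. [cite: GesmundoIkenmeyerPanova2017, Prop. 18 (statement and proof)] -/
theorem GIP2017_prop18_corrected_of_atoms
    (hA1 : ∀ x ∈ ({1, 3, 4, 5, 6, 7, 8, 9, 10, 11, 12, 13, 14} : Finset ℕ), SmPos 7 (ofColumns {2, x}))
    (hA2 : SmPos 7 (ofColumns {2, 2, 2}))
    (hA3 : ∀ a ∈ ({1, 5, 6, 10, 14} : Finset ℕ), ∀ b ∈ ({3, 4, 7, 8, 12} : Finset ℕ),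
      ¬ (a = 1 ∧ (b = 3 ∨ b = 4 ∨ b = 8)) → SmPos 7 (ofColumns {a, b}))
    (hA4 : ∀ x ∈ ({3, 4, 7, 8, 12} : Finset ℕ), ∀ y ∈ ({3, 4, 7, 8, 12} : Finset ℕ),
      ¬ (x = 3 ∧ y = 3) → AmPos 7 (ofColumns {x, y}))
    (hA5 : SmPos 7 (ofColumns {3, 3, 3}))
    (hA6 : ∀ x ∈ ({3, 4, 7, 8, 12} : Finset ℕ), AmPos 7 (ofColumns {2, x}))
    (hA7 : ∀ x ∈ ({3, 4, 7, 8, 12} : Finset ℕ), SmPos 7 (ofColumns {2, 2, x}))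
    (hA8 : SmPos 7 (ofColumns {3, 1, 1, 1}) ∧ SmPos 7 (ofColumns {4, 1, 1}) ∧
      SmPos 7 (ofColumns {8, 1, 1})) :
    GIP2017_prop18_corrected := by
  intro D lam hl hE
  have hlamC : ∀ r, lam.sortedParts.getD r 0 = colCount lam.transpose.parts r :=
    getD_sortedParts_eq_colCount_transpose lam
  have hgood : ∀ c ∈ lam.transpose.parts, 1 ≤ c ∧ c ≤ 14 := fun c hc =>
    ⟨transpose_parts_pos lam c hc, (le_card_parts_of_mem_transpose lam hc).trans hl⟩
  have hexc : lam.transpose.parts ∉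
      ({ {2}, {3}, {4}, {7}, {8}, {12}, {3, 1}, {4, 1}, {8, 1}, {3, 1, 1} } : Finset (Multiset ℕ)) := fun hmem =>
    hE (parts_mem_gipExceptionalShapesCorrected_of_transpose lam hmem)
  have h := smPos_seven_ofColumns_of_atoms hA1 hA2 hA3 hA4 hA5 hA6 hA7 hA8 _ lam.transpose.parts
    le_rfl hgood hexc
  exact SmPos.of_rows_eq (fun r => by rw [hlamC, getD_sortedParts_ofColumns]) h

/-- Hence the barrier fact `GCTMatrixPowering` (= GIP Thm. 10) from the 64 atoms alone
(`gctMatrixPowering_of_prop18`). [cite: GesmundoIkenmeyerPanova2017, Thm. 10 and Prop. 18] -/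
theorem gctMatrixPowering_of_atoms
    (hA1 : ∀ x ∈ ({1, 3, 4, 5, 6, 7, 8, 9, 10, 11, 12, 13, 14} : Finset ℕ), SmPos 7 (ofColumns {2, x}))
    (hA2 : SmPos 7 (ofColumns {2, 2, 2}))
    (hA3 : ∀ a ∈ ({1, 5, 6, 10, 14} : Finset ℕ), ∀ b ∈ ({3, 4, 7, 8, 12} : Finset ℕ),
      ¬ (a = 1 ∧ (b = 3 ∨ b = 4 ∨ b = 8)) → SmPos 7 (ofColumns {a, b}))
    (hA4 : ∀ x ∈ ({3, 4, 7, 8, 12} : Finset ℕ), ∀ y ∈ ({3, 4, 7, 8, 12} : Finset ℕ),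
      ¬ (x = 3 ∧ y = 3) → AmPos 7 (ofColumns {x, y}))
    (hA5 : SmPos 7 (ofColumns {3, 3, 3}))
    (hA6 : ∀ x ∈ ({3, 4, 7, 8, 12} : Finset ℕ), AmPos 7 (ofColumns {2, x}))
    (hA7 : ∀ x ∈ ({3, 4, 7, 8, 12} : Finset ℕ), SmPos 7 (ofColumns {2, 2, x}))
    (hA8 : SmPos 7 (ofColumns {3, 1, 1, 1}) ∧ SmPos 7 (ofColumns {4, 1, 1}) ∧
      SmPos 7 (ofColumns {8, 1, 1})) :
    GCTMatrixPowering :=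
  gctMatrixPowering_of_prop18 (GIP2017_prop18_corrected_of_atoms hA1 hA2 hA3 hA4 hA5 hA6 hA7 hA8)

end Assembly

end Literature.Barriers.ValiantsHypothesis

end
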